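import Summits.SmoothPoincare4.SmoothPoincare4.Theorems.CongruenceShadowsGriffithsHandlebodyExtensionCoverPlanarC
import HarnessLib

/-!
# SmoothPoincare4 / CongruenceShadows — `GriffithsHandlebodyExtension` (item stmt-SmoothPoincare4-15190): the planar family (E3), B.2 — the base disc `e₀`

Support file (`--supports` stmt-SmoothPoincare4-15190) of the homothety-cover proof of the genus-one
clause (E) of Griffiths' handlebody extension theorem — *every self-diffeomorphism of the Heegaard torus
`∂V` of the round solid torus fixing the base point and acting trivially on `π₁(∂V)` extends to a
self-diffeomorphism of `V`* (hypothesis `hE` of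
`Literature.Topology.FourManifolds.RoundSolidTorusModel.diffeoExtends_of_map_ker_eq_ker_of_forall_diffeoExtends`).
See the module docstring of `…CoverDefs` for the whole line (E1–E6) and the notation
(`τ̂`, `δ_λ`, `ρ`, `χ`, `f`, `Δ^(c)`, `α`, `L`, `M`, `Ψ̂`, `ẽ_c`).

This part (E3-B, second half): `PI.exists_base` — a smooth embedding `e₀` of a neighbourhood of the closed unit disc,
equal to `τ` on the unit circle and mapping the closed disc onto the closed Jordan domain `{‖τ' w‖ ≤ 1}` of the curve
`τ(S¹)` (smooth Schoenflies in the plane, the circle diffeotopy dichotomy, radial extension).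
-/

-- the registered namespace `Summit.SmoothPoincare4.SmoothPoincare4.Theorems` repeats a component
set_option linter.dupNamespace false

noncomputable section

namespace Summit.SmoothPoincare4.SmoothPoincare4.Theorems

namespace HomothetyCover

open Set Function Metric Filter
open scoped Topology ContDiff

namespace Planar

open Set Function Metric Filter
open scoped Topology ContDiff Manifold
open Literature.Topology.FourManifolds
attribute [local instance] factFinrankE2
variable {lam : ℝ} (P : PI lam)

section BaseEmbedding

variable {lam : ℝ} (P : PI lam)

namespace PI

/-- The complementary sets cut out by `τ`: inside `{‖τ' w‖ < 1} = τ(𝔹)`, closure `{‖τ' w‖ ≤ 1}`,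
curve `{‖τ' w‖ = 1} = τ(S¹)`. -/
theorem norm_τ'_τ (y : E2) : ‖P.τ' (P.τ y)‖ = ‖y‖ := by rw [P.τ'_τ]

/-- `τ` maps the open unit disc onto `{‖τ' w‖ < 1}`. -/
theorem image_τ_ball : P.τ '' ball (0 : E2) 1 = {w | ‖P.τ' w‖ < 1} := by
  ext w; constructor
  · rintro ⟨y, hy, rfl⟩; simpa [P.τ'_τ] using hy
  · intro hw; exact ⟨P.τ' w, by simpa using hw, P.τ_τ' w⟩

/-- `τ` maps the closed unit disc onto `{‖τ' w‖ ≤ 1}`. -/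
theorem image_τ_closedBall : P.τ '' closedBall (0 : E2) 1 = {w | ‖P.τ' w‖ ≤ 1} := by
  ext w; constructor
  · rintro ⟨y, hy, rfl⟩; simpa [P.τ'_τ] using hy
  · intro hw; exact ⟨P.τ' w, by simpa using hw, P.τ_τ' w⟩

/-- `τ` maps the unit circle onto `{‖τ' w‖ = 1}`. -/
theorem image_τ_sphere : P.τ '' sphere (0 : E2) 1 = {w | ‖P.τ' w‖ = 1} := by
  ext w; constructor
  · rintro ⟨y, hy, rfl⟩; simpa [P.τ'_τ] using hy
  · intro hw; exact ⟨P.τ' w, by simpa using hw, P.τ_τ' w⟩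

/-- The range of `τ` restricted to the unit circle is `{‖τ' w‖ = 1}`. -/
theorem range_τ_sphere : range (fun u : sphere (0 : E2) 1 => P.τ u.1) = {w | ‖P.τ' w‖ = 1} := by
  rw [← image_τ_sphere]
  ext w; constructor
  · rintro ⟨u, rfl⟩; exact ⟨u.1, u.2, rfl⟩
  · rintro ⟨y, hy, rfl⟩; exact ⟨⟨y, hy⟩, rfl⟩

/-- The circle is connected. -/
theorem connectedSpace_circle : ConnectedSpace (sphere (0 : E2) 1) := by
  refine isConnected_iff_connectedSpace.mp (isConnected_sphere ?_ 0 zero_le_one)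
  rw [← Module.finrank_eq_rank, finrank_euclideanSpace_fin]
  exact Nat.one_lt_cast.mpr (by omega)

/-- **The base embedding.**  A smooth `e₀ : ℝ² → ℝ²`, injective with a left inverse smooth at the
image points, equal to `τ` on the unit circle, carrying the closed unit disc onto
`{‖τ' w‖ ≤ 1}` and the open one onto `{‖τ' w‖ < 1}`. -/
theorem exists_base (hlam : 1 < lam) : ∃ e₀ e₀' : E2 → E2,
    ContDiff ℝ ∞ e₀ ∧ (∀ x, e₀' (e₀ x) = x) ∧ (∀ x, ContDiffAt ℝ ∞ e₀' (e₀ x)) ∧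
    (∀ u : E2, ‖u‖ = 1 → e₀ u = P.τ u) ∧
    e₀ '' closedBall (0 : E2) 1 = {w | ‖P.τ' w‖ ≤ 1} ∧ e₀ '' ball (0 : E2) 1 = {w | ‖P.τ' w‖ < 1} := by
  -- B2: Schoenflies
  obtain ⟨e, he, himg, hconn, hunbdd⟩ :=
    SchoenfliesPlane.exists_isSmoothEmbedding_euclidean P.isSmoothEmbedding_τ_sphere
  obtain ⟨hesmooth, heopen, einv, heinv, heinv_smooth⟩ := exists_leftInverse_of_isSmoothEmbedding he
  have hinj : Injective e := he.isEmbedding.injective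
  rw [P.range_τ_sphere] at himg
  -- B4: the circle diffeomorphism `g = e⁻¹ ∘ τ` on `S¹`
  have hτmem : ∀ u : sphere (0 : E2) 1, ∃ v : sphere (0 : E2) 1, e v.1 = P.τ u.1 := by
    intro u
    have : P.τ u.1 ∈ e '' sphere (0 : E2) 1 := by
      rw [himg]; show ‖P.τ' (P.τ u.1)‖ = 1; rw [P.τ'_τ]; exact norm_eq_of_mem_sphere u
    obtain ⟨v, hv, hve⟩ := this
    exact ⟨⟨v, hv⟩, hve⟩
  have he_einv_τ : ∀ u : sphere (0 : E2) 1, e (einv (P.τ u.1)) = P.τ u.1 := by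
    intro u; obtain ⟨v, hv⟩ := hτmem u; rw [← hv, heinv]
  have hg_mem : ∀ u : sphere (0 : E2) 1, einv (P.τ u.1) ∈ sphere (0 : E2) 1 := by
    intro u; obtain ⟨v, hv⟩ := hτmem u; rw [← hv, heinv]; exact v.2
  have hemem : ∀ v : sphere (0 : E2) 1, ∃ u : sphere (0 : E2) 1, P.τ u.1 = e v.1 := by
    intro v
    have : e v.1 ∈ e '' sphere (0 : E2) 1 := mem_image_of_mem _ v.2
    rw [himg] at this
    exact ⟨⟨P.τ' (e v.1), by simpa using this⟩, P.τ_τ' _⟩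
  have hg'_mem : ∀ v : sphere (0 : E2) 1, P.τ' (e v.1) ∈ sphere (0 : E2) 1 := by
    intro v; obtain ⟨u, hu⟩ := hemem v; rw [← hu, P.τ'_τ]; exact u.2
  have hgcont : ContMDiff (𝓡 1) (𝓡 2) ∞ (fun u : sphere (0 : E2) 1 => einv (P.τ u.1)) := by
    intro u
    have h1 : ContMDiffAt (𝓡 1) (𝓡 2) ∞ (fun u : sphere (0 : E2) 1 => P.τ u.1) u :=
      P.isSmoothEmbedding_τ_sphere.contMDiff u
    have h2 : ContDiffAt ℝ ∞ einv (P.τ u.1) := by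
      obtain ⟨v, hv⟩ := hτmem u; rw [← hv]; exact heinv_smooth _
    exact h2.contMDiffAt.comp u h1
  have hg'cont : ContMDiff (𝓡 1) (𝓡 2) ∞ (fun v : sphere (0 : E2) 1 => P.τ' (e v.1)) := by
    intro v
    have h1 : ContMDiffAt (𝓡 1) (𝓡 2) ∞ (fun v : sphere (0 : E2) 1 => e v.1) v :=
      hesmooth.contMDiff.contMDiffAt.comp v (contMDiff_coe_sphere v)
    have h2 : ContDiffAt ℝ ∞ P.τ' (e v.1) := by
      apply P.contDiffAt_τ'
      obtain ⟨u, hu⟩ := hemem v; rw [← hu]; exact P.τ_ne_zero (ne_zero_of_mem_unit_sphere u)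
    exact h2.contMDiffAt.comp v h1
  set gD : sphere (0 : E2) 1 ≃ₘ⟮𝓡 1, 𝓡 1⟯ sphere (0 : E2) 1 :=
    { toFun := fun u => ⟨einv (P.τ u.1), hg_mem u⟩
      invFun := fun v => ⟨P.τ' (e v.1), hg'_mem v⟩
      left_inv := fun u => Subtype.ext (by simp only; rw [he_einv_τ, P.τ'_τ])
      right_inv := fun v => Subtype.ext (by simp only; rw [P.τ_τ', heinv])
      contMDiff_toFun := hgcont.codRestrict_sphere hg_mem
      contMDiff_invFun := hg'cont.codRestrict_sphere hg'_mem } with hgD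
  have hgD_apply : ∀ u : sphere (0 : E2) 1, (gD u : E2) = einv (P.τ u.1) := fun u => rfl
  -- B5: extension of `gD` to a diffeomorphism `Gext` of the plane
  haveI := connectedSpace_circle
  obtain ⟨Gext, hGext, hGnorm⟩ : ∃ Gext : E2 ≃ₘ⟮𝓘(ℝ, E2), 𝓘(ℝ, E2)⟯ E2,
      (∀ u : sphere (0 : E2) 1, Gext u.1 = (gD u : E2)) ∧ (∀ x, ‖Gext x‖ = ‖x‖) := by
    rcases Diffeomorph.isIsotopic_refl_or_circleConj_holds gD with h | h
    · -- `gD` diffeotopic to the identity: radial extension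
      have hd : Diffeomorph.IsDiffeotopicToId gD := by
        have h1 := h.isDiffeotopic
        obtain ⟨D, hD⟩ := h1
        have h2 : Diffeomorph.IsDiffeotopicToId gD.symm := ⟨D, by rw [hD]; ext x; rfl⟩
        have h3 := h2.symm
        have e : gD.symm.symm = gD := by ext x; rfl
        rwa [e] at h3
      obtain ⟨D, hD⟩ := hd
      refine ⟨D.radialExtension, fun u => ?_, fun x => ?_⟩
      · rw [Diffeotopy.coe_radialExtension, radialExtensionFun_coe_sphere]
        show ((D.stage 1) u : E2) = _
        rw [hD]
      · rw [Diffeotopy.coe_radialExtension, norm_radialExtensionFun]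
    · -- `gD` diffeotopic to complex conjugation: compose with the linear reflection
      set B : E2 ≃ₗᵢ[ℝ] E2 := LinearIsometryEquiv.piLpCongrRight 2
        (fun i : Fin 2 => if i = 1 then LinearIsometryEquiv.neg ℝ else LinearIsometryEquiv.refl ℝ ℝ) with hB
      have hBapply : ∀ (y : E2) (i : Fin 2), B y i = if i = 1 then -y i else y i := by
        intro y i
        rw [hB, LinearIsometryEquiv.piLpCongrRight_apply]
        by_cases hi : i = 1
        · subst hi; simp
        · simp [hi]
      have hBconj : ∀ u : sphere (0 : E2) 1, B u.1 = (circleConj u : E2) := by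
        intro u; ext i; rw [hBapply, coe_circleConj_apply]
      obtain ⟨D, hD⟩ := h.isDiffeotopic
      -- `D.stage 1 = gD.symm.trans circleConj =: φ₁`, and `gD = circleConj ≫ φ₁⁻¹`
      have hφ0 : Diffeomorph.IsDiffeotopicToId (gD.symm.trans circleConj) := ⟨D, hD⟩
      obtain ⟨D', hD'⟩ := hφ0.symm
      have hgD_eq : ∀ y : sphere (0 : E2) 1, gD y = (gD.symm.trans circleConj).symm (circleConj y) := by
        intro y
        have h1 : (gD.symm.trans circleConj) (gD y) = circleConj y := by
          show circleConj (gD.symm (gD y)) = circleConj y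
          rw [Diffeomorph.symm_apply_apply]
        rw [← h1, Diffeomorph.symm_apply_apply]
      refine ⟨B.toContinuousLinearEquiv.toDiffeomorph.trans D'.radialExtension, fun u => ?_, fun x => ?_⟩
      · rw [Diffeomorph.coe_trans, Function.comp_apply, ContinuousLinearEquiv.coe_toDiffeomorph,
          Diffeotopy.coe_radialExtension]
        show radialExtensionFun D'.toFun (B u.1) = _
        rw [hBconj u, radialExtensionFun_coe_sphere]
        show ((D'.stage 1) (circleConj u) : E2) = _
        rw [hD', hgD_eq u]
      · rw [Diffeomorph.coe_trans, Function.comp_apply, ContinuousLinearEquiv.coe_toDiffeomorph,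
          Diffeotopy.coe_radialExtension, norm_radialExtensionFun]
        exact B.norm_map x
  -- B6: the base embedding `e₀ = e ∘ Gext`
  have hGsmooth : ContDiff ℝ ∞ Gext := contMDiff_iff_contDiff.1 Gext.contMDiff
  have hGsmooth' : ContDiff ℝ ∞ Gext.symm := contMDiff_iff_contDiff.1 Gext.symm.contMDiff
  have hGnorm' : ∀ x, ‖Gext.symm x‖ = ‖x‖ := fun x => by
    conv_rhs => rw [← Gext.apply_symm_apply x]; rw [hGnorm]
  have hGball : Gext '' ball (0 : E2) 1 = ball 0 1 := by
    ext x; simp only [mem_image, mem_ball, dist_zero_right]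
    constructor
    · rintro ⟨y, hy, rfl⟩; rwa [hGnorm]
    · intro hx; exact ⟨Gext.symm x, by rwa [hGnorm'], Gext.apply_symm_apply x⟩
  have hGclosedBall : Gext '' closedBall (0 : E2) 1 = closedBall 0 1 := by
    ext x; simp only [mem_image, mem_closedBall, dist_zero_right]
    constructor
    · rintro ⟨y, hy, rfl⟩; rwa [hGnorm]
    · intro hx; exact ⟨Gext.symm x, by rwa [hGnorm'], Gext.apply_symm_apply x⟩
  have hGsphere : Gext '' sphere (0 : E2) 1 = sphere 0 1 := by
    ext x; simp only [mem_image, mem_sphere, dist_zero_right]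
    constructor
    · rintro ⟨y, hy, rfl⟩; rwa [hGnorm]
    · intro hx; exact ⟨Gext.symm x, by rwa [hGnorm'], Gext.apply_symm_apply x⟩
  set e₀ : E2 → E2 := e ∘ Gext with he₀
  set e₀' : E2 → E2 := Gext.symm ∘ einv with he₀'
  have he₀ball : e₀ '' ball (0 : E2) 1 = e '' ball 0 1 := by rw [he₀, image_comp, hGball]
  have he₀closedBall : e₀ '' closedBall (0 : E2) 1 = e '' closedBall 0 1 := by
    rw [he₀, image_comp, hGclosedBall]
  have he₀sphere : e₀ '' sphere (0 : E2) 1 = {w | ‖P.τ' w‖ = 1} := by rw [he₀, image_comp, hGsphere, himg]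
  have he₀inj : Injective e₀ := hinj.comp Gext.injective
  -- B7: Jordan bookkeeping: `e '' closedBall = {‖τ' w‖ ≤ 1}`
  set U := e '' ball (0 : E2) 1 with hU
  set F := e '' closedBall (0 : E2) 1 with hF
  set Tint := {w : E2 | ‖P.τ' w‖ < 1} with hTint
  set T := {w : E2 | ‖P.τ' w‖ ≤ 1} with hT
  have hτ'c : Continuous P.τ' := P.continuous_τ' hlam
  have hτc : Continuous P.τ := P.continuous_τ hlam
  have hTint_open : IsOpen Tint := isOpen_lt (continuous_norm.comp hτ'c) continuous_const
  have hT_closed : IsClosed T := isClosed_le (continuous_norm.comp hτ'c) continuous_const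
  have hTc_open : IsOpen Tᶜ := hT_closed.isOpen_compl
  have hTint_conn : IsPreconnected Tint := by
    rw [hTint, ← P.image_τ_ball]; exact isPreconnected_ball.image _ hτc.continuousOn
  have hU_conn : IsPreconnected U := isPreconnected_ball.image _ hesmooth.continuous.continuousOn
  have hU_open : IsOpen U := heopen _ isOpen_ball
  have hF_compact : IsCompact F := (isCompact_closedBall _ _).image hesmooth.continuous
  have hFc_open : IsOpen Fᶜ := hF_compact.isClosed.isOpen_compl
  have hT_bdd : Bornology.IsBounded T := by
    rw [hT, ← P.image_τ_closedBall]; exact ((isCompact_closedBall _ _).image hτc).isBounded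
  have hTint_sub_T : Tint ⊆ T := fun w hw => le_of_lt (show ‖P.τ' w‖ < 1 from hw)
  have hC : e '' sphere (0 : E2) 1 = {w | ‖P.τ' w‖ = 1} := himg
  have hF_eq : F = U ∪ e '' sphere 0 1 := by rw [hF, hU, ← image_union, ball_union_sphere]
  have hUF : U ⊆ F := image_mono ball_subset_closedBall
  have h0Tint : (0 : E2) ∈ Tint := by
    show ‖P.τ' 0‖ < 1; rw [P.τ'_zero, norm_zero]; exact one_pos
  have hdisjT : Disjoint Tint Tᶜ := disjoint_compl_right.mono_left hTint_sub_T
  have hnotC : ∀ w, w ∉ e '' sphere (0 : E2) 1 → w ∈ Tint ∪ Tᶜ := by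
    intro w hwC
    rw [hC] at hwC
    rcases lt_or_gt_of_ne hwC with h | h
    · exact Or.inl h
    · exact Or.inr (fun hle => absurd (lt_of_le_of_lt hle h) (lt_irrefl _))
  -- Step 1: `Tint` lies inside `U` or inside `Fᶜ`
  have hstep1 : Tint ⊆ U ∪ Fᶜ := by
    intro w hw
    by_cases hwF : w ∈ F
    · rw [hF_eq] at hwF
      rcases hwF with hwU | hwC
      · exact Or.inl hwU
      · rw [hC] at hwC; exact absurd hwC (ne_of_lt hw)
    · exact Or.inr hwF
  have hdisj1 : Disjoint U Fᶜ := disjoint_compl_right.mono_left hUF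
  rcases hTint_conn.subset_or_subset hU_open hFc_open hdisj1 hstep1 with hTU | hTFc
  · -- Step 3: `U ⊆ Tint`, hence `U = Tint`
    have hstepU : U ⊆ Tint ∪ Tᶜ := by
      intro w hwU
      refine hnotC w ?_
      rintro ⟨v, hv, hvw⟩
      obtain ⟨y, hy, hyw⟩ := hwU
      have := hinj (hyw.trans hvw.symm); subst this
      rw [mem_sphere_zero_iff_norm] at hv; rw [mem_ball_zero_iff] at hy; linarith
    have hUT : U ⊆ Tint :=
      hU_conn.subset_left_of_subset_union hTint_open hTc_open hdisjT hstepU ⟨0, hTU h0Tint, h0Tint⟩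
    have hUeq : U = Tint := Subset.antisymm hUT hTU
    refine ⟨e₀, e₀', hesmooth.comp hGsmooth, fun x => ?_, fun x => ?_, fun u hu => ?_, ?_, ?_⟩
    · show Gext.symm (einv (e (Gext x))) = x; rw [heinv, Gext.symm_apply_apply]
    · show ContDiffAt ℝ ∞ (Gext.symm ∘ einv) (e (Gext x))
      exact hGsmooth'.contDiffAt.comp _ (heinv_smooth _)
    · have hmem : u ∈ sphere (0 : E2) 1 := by simp [hu]
      show e (Gext u) = P.τ u
      rw [hGext ⟨u, hmem⟩, hgD_apply, he_einv_τ ⟨u, hmem⟩]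
    · rw [he₀closedBall, hF_eq, hUeq, hC]
      ext w
      simp only [mem_union, mem_setOf_eq, hTint]
      exact le_iff_lt_or_eq.symm
    · rw [he₀ball, hUeq]
  · -- Step 2: `Tint ⊆ Fᶜ` would force `Fᶜ ⊆ Tint`, bounded: contradiction
    exfalso
    have h0Fc : (0 : E2) ∈ Fᶜ := hTFc h0Tint
    have hstep2 : Fᶜ ⊆ Tint ∪ Tᶜ := fun w hw => hnotC w (fun h => hw (hF_eq ▸ Or.inr h))
    have hFcT : Fᶜ ⊆ Tint :=
      hconn.isPreconnected.subset_left_of_subset_union hTint_open hTc_open hdisjT hstep2 ⟨0, h0Fc, h0Tint⟩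
    exact hunbdd (hT_bdd.subset (hFcT.trans hTint_sub_T))

end PI

end BaseEmbedding

end Planar

end HomothetyCover

end Summit.SmoothPoincare4.SmoothPoincare4.Theorems

end
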